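import Summits.QuantumFields.YangMills.Theorems.FluctuationComparisonRegPrIntLS2BetaChartContCovariance
import HarnessLib

/-!
# CHART∞ · V-b2 (LINE g18-1 `semiclassical_s2beta`, organ S2β, LAPLACE row): GAUGE INVARIANCE OF THE JACOBIAN AT EVERY STRICT-LIVE POINT

R3 = Bałaban's UV-stability programme on the finite 3-torus, gauge group `SU(N)` (generic `(P, N)` here) — NOT d = 4, NOT infinite volume, NOT a mass gap,
NOT Clay; the Yang–Mills gap is NOT proved by anything in this file.  Helper toward crux `stmt-QuantumFields-20520` (`FluctuationComparisonRegPrIntL`),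
LINE g18-1, LAPLACE row, letter CHART∞ (V) «docking edition», part (c).

✓V-b1 `jac_gaugeAct_ae_eq` gives `Jac (uₙ • V, u • z) = Jac (V, z)` for ALMOST every `(V, z)`.  THIS FILE upgrades it to EVERY live point `(V, z₀)` whose charted
field has strict small loop history (`jac_gaugeAct_eq_of_live`), which is what the LAPLACE carrier consists of: (i) reduce to the self-charted base point
`w₀ := Φ (V, z₀)` (pivot blindness of both sides); (ii) both `Jac` and `Jac ∘ γᵤ` are continuous WITHIN the window graph at `(V, w₀)` (the TRANSFER conjunct (20) of
CHART∞ IV-c; gauge invariance of the loop variables), so if they differed there they would differ on `N ∩ graph` for a product neighbourhood `N = N_V × N_z`;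
(iii) the bad set is pivot-saturated and therefore contains `Φ⁻¹ B ∩ {Jac ≠ 0}` for `B := Ū⁽ⁿ⁾⁻¹ N_V ∩ N_z`, whose `Jac`-weighted measure is `ν (B ∩ chart-window set)`
by the fibred law; (iv) `B ∩ chart-window set` is a neighbourhood of `w₀` (continuity of `Ū⁽ⁿ⁾` at `w₀`, `mem_chartWindowSet_of_loopSmall`, ✓`isOpen_loopSmallSet_lt`),
hence has positive product-Haar measure (✓`isOpenPosMeasure_fieldMeasure_SU`) — contradicting the a.e. statement.
[cite: Balaban1987RG1, (0.4) p.253, (2.1) p.265 and (2.10) p.267] [cite: Balaban1985Averaging, (8) p.19 and (11) p.19]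
-/

noncomputable section

open MeasureTheory Filter Topology Set
open scoped ENNReal NNReal
open Literature.MathematicalPhysics.QuantumFieldTheory.Balaban1983to89
open Literature.MathematicalPhysics.QuantumFieldTheory.Balaban1983to89.T4Continuum

namespace Summit.QuantumFields.YangMills.Theorems.FluctuationComparisonRegPrIntLS2BetaChartContCovariancePointwise

open Summit.QuantumFields.YangMills.Theorems.FluctuationComparisonRegPrIntLWregChain
open Summit.QuantumFields.YangMills.Theorems.FluctuationComparisonRegPrIntLWregFibredChart
open Summit.QuantumFields.YangMills.Theorems.FluctuationComparisonRegPrIntLWregChartCharge (continuousAt_iter_of_loopSmall)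
open Summit.QuantumFields.YangMills.Theorems.FluctuationComparisonRegPrIntLS2BetaChartContFibredChart (isOpen_loopSmallSet_lt)
open Summit.QuantumFields.YangMills.Theorems.FluctuationComparisonRegPrIntLS2BetaChartContCarrier
open Summit.QuantumFields.YangMills.Theorems.FluctuationComparisonRegPrIntLS2BetaChartContCovariance
open Function
open Literature.MathematicalPhysics.QuantumFieldTheory.Balaban1983to89.BlockAveraging (Idx loopHol measurable_avgFun)
open Literature.MathematicalPhysics.QuantumFieldTheory.Balaban1983to89.BlockAveragingHaarAC (centralBond)
open Literature.MathematicalPhysics.QuantumFieldTheory.Balaban1983to89.ExpMeanLog (expMeanLogSU deltaSU measurable_expMeanLogSU_E)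
open Literature.MathematicalPhysics.QuantumFieldTheory.Balaban1983to89.Node00 (SU)
open Summit.QuantumFields.YangMills.BalabanUVNodes.N09CentralWindowAtRecord (self_mem_centralWindow_iff)

variable {P : Params} {N : ℕ} [NeZero N]

/-! ## §1 Letters: continuity of the gauge action, gauge invariance of the loop history, loop-small fields are charted -/

/-- A fixed gauge transformation acts continuously on configurations. [cite: Balaban1985Averaging, (8) p.19] -/
theorem continuous_gaugeAct {j : ℕ} (u : GaugeTransf P j (SU N)) :
    Continuous (GaugeField.gaugeAct u : GaugeField P j (SU N) → GaugeField P j (SU N)) :=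
  continuous_pi fun b => (continuous_const.mul (continuous_apply b)).mul continuous_const

/-- The loop variables of the averaged fields are gauge invariant in `dist1`. [cite: Balaban1985Averaging, (11)-(12) p.19] -/
theorem dist1_loopHol_iter_gaugeAct {k : ℕ} (hk : k ≤ P.m + P.K) (u : GaugeTransf P 0 (SU N)) (U : GaugeField P 0 (SU N))
    (c : PBond P (k + 1)) (i : Idx P) :
    dist1 (loopHol (Averaging.iter (fun i => BlockAveraging.blockAvg (P := P) (j := i) (expMeanLogSU (n := Fin N))) k (GaugeField.gaugeAct u U)) c i) =
      dist1 (loopHol (Averaging.iter (fun i => BlockAveraging.blockAvg (P := P) (j := i) (expMeanLogSU (n := Fin N))) k U) c i) := by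
  rw [iter_gaugeAct _ u k hk, BlockAveraging.loopHol_gaugeAct, GaugeGroup.dist1_conj]

/-- ★ A field with small loop history below level `n` lies in the chart-window set (loop-currency twin of ✓`self_mem_chainWindow`).
[cite: Balaban1987RG1, (0.4) p.253 and (2.9) p.266 (bookkeeping)] -/
theorem mem_chartWindowSet_of_loopSmall {α : ℝ} :
    ∀ {n : ℕ}, n ≤ P.m + P.K → ∀ (U : GaugeField P 0 (SU N)),
      (∀ k, k < n → ∀ (c' : PBond P (k + 1)) (i : Idx P),
        dist1 (loopHol (Averaging.iter (fun i => BlockAveraging.blockAvg (P := P) (j := i) (expMeanLogSU (n := Fin N))) k U) c' i) ≤ α) →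
      ∀ c, U (iterCentralBond n c) ∈ chainWindow (N := N) α n U c
  | 0, _ => fun _ _ _ => mem_univ _
  | n + 1, hn => fun U hU c => by
      refine ⟨mem_chartWindowSet_of_loopSmall (n := n) (by omega) U (fun k hk => hU k (by omega)) (centralBond c), ?_⟩
      show chainMap (expMeanLogSU (n := Fin N)) n U (centralBond c) (U (iterCentralBond n (centralBond c))) ∈ _
      rw [chainMap_self]
      exact (self_mem_centralWindow_iff (by omega) _ c α).2 fun i => hU n (lt_add_one n) c i

/-! ## §2 The pointwise edition -/

/-- ★★★ **THE JACOBIAN IS GAUGE INVARIANT AT EVERY STRICT-LIVE POINT**: `Jac (uₙ • V, u • z₀) = Jac (V, z₀)` whenever `Jac (V, z₀) ≠ 0` and the charted field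
`Φ (V, z₀)` has strict small loop history below level `n` (see the module docstring for the argument).
[cite: Balaban1987RG1, (0.4) p.253, (2.1) p.265 and (2.10) p.267] [cite: Balaban1985Averaging, (8) p.19 and (11) p.19] -/
theorem jac_gaugeAct_eq_of_live {α : ℝ} (hαδ : α < deltaSU (Fin N)) {n : ℕ} (hn : n ≤ P.m + P.K)
    {Φ : GaugeField P n (SU N) × GaugeField P 0 (SU N) → GaugeField P 0 (SU N)} {Jac : GaugeField P n (SU N) × GaugeField P 0 (SU N) → ℝ≥0}
    {T : PBond P n → GaugeField P 0 (SU N) → Set (SU N)}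
    (hΦm : Measurable Φ) (hJm : Measurable Jac)
    (hfib : ∀ V z, Jac (V, z) ≠ 0 →
      Averaging.iter (fun i => BlockAveraging.blockAvg (P := P) (j := i) (expMeanLogSU (n := Fin N))) n (Φ (V, z)) = V)
    (hlaw : ∀ U₀ : Set (GaugeField P n (SU N)), MeasurableSet U₀ →
      (fieldMeasure P 0 (SU N)).restrict
          (Averaging.iter (fun i => BlockAveraging.blockAvg (P := P) (j := i) (expMeanLogSU (n := Fin N))) n ⁻¹' U₀ ∩
            {U | ∀ c, U (iterCentralBond n c) ∈ chainWindow (N := N) α n U c}) =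
        ((((fieldMeasure P n (SU N)).restrict U₀).prod (fieldMeasure P 0 (SU N))).withDensity fun p => (Jac p : ℝ≥0∞)).map Φ)
    (hJT : ∀ V z, Jac (V, z) ≠ 0 ↔ ∀ c, V c ∈ T c z)
    (hcharted : ∀ V z, (∀ c, V c ∈ T c z) → (∀ b, (∀ c, iterCentralBond n c ≠ b) → Φ (V, z) b = z b) ∧
        ∀ c, Φ (V, z) (iterCentralBond n c) ∈ chainWindow (N := N) α n (Φ (V, z)) c)
    (hrecog : ∀ V z (g : PBond P n → SU N), (∀ c, g c ∈ chainWindow (N := N) α n z c) →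
        (∀ c, V c = Averaging.iter (fun i => BlockAveraging.blockAvg (P := P) (j := i) (expMeanLogSU (n := Fin N))) n
          (extend (iterCentralBond n) g z) c) →
        Jac (V, z) ≠ 0 ∧ Φ (V, z) = extend (iterCentralBond n) g z)
    (htransfer : ∀ (V : GaugeField P n (SU N)) (z₀ : GaugeField P 0 (SU N)), (∀ c, V c ∈ T c z₀) →
        (∀ k, k < n → ∀ (c' : PBond P (k + 1)) (i : Idx P),
          dist1 (loopHol (Averaging.iter (fun i => BlockAveraging.blockAvg (P := P) (j := i) (expMeanLogSU (n := Fin N))) k (Φ (V, z₀))) c' i) < α) →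
        ContinuousWithinAt Φ {p : GaugeField P n (SU N) × GaugeField P 0 (SU N) | ∀ c, p.1 c ∈ T c p.2} (V, z₀) ∧
        ContinuousWithinAt Jac {p : GaugeField P n (SU N) × GaugeField P 0 (SU N) | ∀ c, p.1 c ∈ T c p.2} (V, z₀))
    (hTbl : ∀ c z (g : PBond P n → SU N), T c (extend (iterCentralBond n) g z) = T c z)
    (hΦbl : ∀ V z (g : PBond P n → SU N), (∀ c, V c ∈ T c z) → Φ (V, extend (iterCentralBond n) g z) = Φ (V, z))
    (hJbl : ∀ V z (g : PBond P n → SU N), Jac (V, extend (iterCentralBond n) g z) = Jac (V, z))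
    (u : GaugeTransf P 0 (SU N)) (V : GaugeField P n (SU N)) (z₀ : GaugeField P 0 (SU N)) (hJ : Jac (V, z₀) ≠ 0)
    (hstrict : ∀ k, k < n → ∀ (c' : PBond P (k + 1)) (i : Idx P),
      dist1 (loopHol (Averaging.iter (fun i => BlockAveraging.blockAvg (P := P) (j := i) (expMeanLogSU (n := Fin N))) k (Φ (V, z₀))) c' i) < α) :
    Jac (GaugeField.gaugeAct (transfUp u n) V, GaugeField.gaugeAct u z₀) = Jac (V, z₀) := by
  classical
  haveI : IsProbabilityMeasure (HaarData.haar (G := SU N)) := HaarData.isProb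
  haveI : BorelSpace (GaugeField P 0 (SU N)) := inferInstanceAs (BorelSpace (PBond P 0 → SU N))
  haveI : BorelSpace (GaugeField P n (SU N)) := inferInstanceAs (BorelSpace (PBond P n → SU N))
  haveI := B12ContinuousTransportInvariance.isOpenPosMeasure_fieldMeasure_SU N P 0
  have hβ := iterCentralBond_injective (P := P) (n := n) hn
  set μ : Measure (GaugeField P n (SU N)) := fieldMeasure P n (SU N) with hμ
  set ν : Measure (GaugeField P 0 (SU N)) := fieldMeasure P 0 (SU N) with hν
  set A := Averaging.iter (fun i => BlockAveraging.blockAvg (P := P) (j := i) (expMeanLogSU (n := Fin N))) n with hA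
  have hAm : Measurable A :=
    T4Continuum.measurable_iter _ (fun j => by rw [BlockAveraging.blockAvg_avg]; exact measurable_avgFun _ measurable_expMeanLogSU_E) n
  set gV : GaugeField P n (SU N) → GaugeField P n (SU N) := GaugeField.gaugeAct (transfUp u n) with hgV
  set gz : GaugeField P 0 (SU N) → GaugeField P 0 (SU N) := GaugeField.gaugeAct u with hgz
  set γ : GaugeField P n (SU N) × GaugeField P 0 (SU N) → GaugeField P n (SU N) × GaugeField P 0 (SU N) := fun p => (gV p.1, gz p.2) with hγ
  have hγc : Continuous γ := ((continuous_gaugeAct _).comp continuous_fst).prodMk ((continuous_gaugeAct _).comp continuous_snd)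
  set J : GaugeField P n (SU N) × GaugeField P 0 (SU N) → ℝ≥0∞ := fun p => (Jac p : ℝ≥0∞) with hJdef
  have hJmeas : Measurable J := hJm.coe_nnreal_ennreal
  -- blindness identities along `w ↦ z[βₙ ↦ w ∘ βₙ]`
  have hblind : ∀ (V' : GaugeField P n (SU N)) (z : GaugeField P 0 (SU N)), (∀ c, V' c ∈ T c z) →
      let w := Φ (V', z)
      Jac (V', w) = Jac (V', z) ∧ Jac (γ (V', w)) = Jac (γ (V', z)) ∧ Φ (V', w) = w ∧ (∀ c, V' c ∈ T c w) := by
    intro V' z hV'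
    have hext : extend (iterCentralBond n) (fun c => Φ (V', z) (iterCentralBond n c)) z = Φ (V', z) :=
      extend_chart_pivots_eq (P := P) (N := N) hn hcharted V' z hV'
    refine ⟨by rw [← hext, hJbl], ?_, ?_, fun c => by rw [← hext, hTbl]; exact hV' c⟩
    · show Jac (gV V', gz (Φ (V', z))) = Jac (gV V', gz z)
      rw [← hext, hgz, gaugeAct_extend hn, hJbl]
    · have h := hΦbl V' z (fun c => Φ (V', z) (iterCentralBond n c)) hV'
      rw [hext] at h
      exact h
  by_contra hne
  -- (i) move to the self-charted base point `w₀ := Φ (V, z₀)`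
  have hV : ∀ c, V c ∈ T c z₀ := (hJT V z₀).1 hJ
  obtain ⟨hJw, hJγw, hΦw, hVw⟩ := hblind V z₀ hV
  set w₀ := Φ (V, z₀) with hw₀
  have hne' : Jac (γ (V, w₀)) ≠ Jac (V, w₀) := by rw [hJγw, hJw]; exact hne
  -- (ii) continuity within the window graph at `(V, w₀)` of `Jac` and of `Jac ∘ γ`
  have hGγ : MapsTo γ {p : GaugeField P n (SU N) × GaugeField P 0 (SU N) | ∀ c, p.1 c ∈ T c p.2}
      {p : GaugeField P n (SU N) × GaugeField P 0 (SU N) | ∀ c, p.1 c ∈ T c p.2} := fun p hp =>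
    (hJT _ _).1 (chart_gaugeAct (P := P) (N := N) hn hfib hJT hcharted hrecog u p.1 p.2 ((hJT _ _).2 hp)).1
  have hstrictw : ∀ k, k < n → ∀ (c' : PBond P (k + 1)) (i : Idx P), dist1 (loopHol (Averaging.iter
      (fun i => BlockAveraging.blockAvg (P := P) (j := i) (expMeanLogSU (n := Fin N))) k (Φ (V, w₀))) c' i) < α := by
    rw [hΦw]; exact hstrict
  have hstrictγ : ∀ k, k < n → ∀ (c' : PBond P (k + 1)) (i : Idx P), dist1 (loopHol (Averaging.iter
      (fun i => BlockAveraging.blockAvg (P := P) (j := i) (expMeanLogSU (n := Fin N))) k (Φ (γ (V, w₀)))) c' i) < α := by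
    intro k hk c' i
    have hΦγ : Φ (γ (V, w₀)) = gz (Φ (V, w₀)) :=
      (chart_gaugeAct (P := P) (N := N) hn hfib hJT hcharted hrecog u V w₀ ((hJT _ _).2 hVw)).2
    rw [hΦγ, hgz, dist1_loopHol_iter_gaugeAct (by omega)]
    exact hstrictw k hk c' i
  have hcJ : ContinuousWithinAt (fun p => (Jac p : ℝ)) {p : GaugeField P n (SU N) × GaugeField P 0 (SU N) | ∀ c, p.1 c ∈ T c p.2} (V, w₀) :=
    NNReal.continuous_coe.continuousAt.comp_continuousWithinAt (htransfer V w₀ hVw hstrictw).2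
  have hcJγ : ContinuousWithinAt (fun p => (Jac (γ p) : ℝ)) {p : GaugeField P n (SU N) × GaugeField P 0 (SU N) | ∀ c, p.1 c ∈ T c p.2} (V, w₀) := by
    have h1 := (htransfer (γ (V, w₀)).1 (γ (V, w₀)).2 (hGγ hVw) hstrictγ).2
    have h2 : ContinuousWithinAt (fun p => Jac (γ p)) {p : GaugeField P n (SU N) × GaugeField P 0 (SU N) | ∀ c, p.1 c ∈ T c p.2} (V, w₀) :=
      ContinuousWithinAt.comp (f := γ) (x := ((V, w₀) : GaugeField P n (SU N) × GaugeField P 0 (SU N))) h1 hγc.continuousWithinAt hGγ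
    exact NNReal.continuous_coe.continuousAt.comp_continuousWithinAt h2
  have hev : ∀ᶠ p in 𝓝[{p : GaugeField P n (SU N) × GaugeField P 0 (SU N) | ∀ c, p.1 c ∈ T c p.2}] ((V, w₀) : _ × _),
      (Jac (γ p) : ℝ) - Jac p ≠ 0 :=
    (hcJγ.sub hcJ).eventually_ne (sub_ne_zero.2 fun h => hne' (NNReal.coe_injective h))
  rw [eventually_nhdsWithin_iff] at hev
  obtain ⟨N_V, N_z, hNVo, hVN, hNzo, hwN, hprod⟩ := mem_nhds_prod_iff'.1 hev
  -- (iii) the bad set: null by V-b1, pivot-saturated, hence ⊇ Φ⁻¹ B ∩ {Jac ≠ 0}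
  have hE0 : (μ.prod ν) {p | Jac (γ p) ≠ Jac p} = 0 := by
    have h := jac_gaugeAct_ae_eq (P := P) (N := N) hn hΦm hJm hfib hlaw hJT hcharted hrecog hJbl u
    rw [ae_iff] at h
    simpa only [not_not] using h
  set B : Set (GaugeField P 0 (SU N)) := A ⁻¹' N_V ∩ N_z with hB
  have hBm : MeasurableSet B := (hAm hNVo.measurableSet).inter hNzo.measurableSet
  have hsub : Φ ⁻¹' B ⊆ {p | Jac (γ p) ≠ Jac p} ∪ {p | J p = 0} := by
    intro p hp
    by_cases hJp : Jac p = 0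
    · exact Or.inr (by show (Jac p : ℝ≥0∞) = 0; rw [hJp, ENNReal.coe_zero])
    refine Or.inl ?_
    have hV' : ∀ c, p.1 c ∈ T c p.2 := (hJT p.1 p.2).1 hJp
    obtain ⟨hJw', hJγw', -, hVw'⟩ := hblind p.1 p.2 hV'
    have hmemN : ((p.1, Φ (p.1, p.2)) : GaugeField P n (SU N) × GaugeField P 0 (SU N)) ∈ N_V ×ˢ N_z :=
      ⟨by have h := hp.1; rwa [mem_preimage, hfib p.1 p.2 hJp] at h, hp.2⟩
    have h := hprod hmemN hVw'
    show Jac (γ p) ≠ Jac p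
    rw [← hJw', ← hJγw']
    exact fun h' => h (sub_eq_zero.2 (by rw [h']))
  -- (iv) `B ∩ chart-window set` is a neighbourhood of `w₀`, so has positive measure; but its measure is the `Jac`-weight of `Φ⁻¹ B`, which is zero
  have hwB : {U : GaugeField P 0 (SU N) | ∀ k, k < n → ∀ (c' : PBond P (k + 1)) (i : Idx P),
      dist1 (loopHol (Averaging.iter (fun i => BlockAveraging.blockAvg (P := P) (j := i) (expMeanLogSU (n := Fin N))) k U) c' i) < α} ∩ B ∈ 𝓝 w₀ := by
    refine Filter.inter_mem ((isOpen_loopSmallSet_lt (P := P) (N := N) hαδ n).mem_nhds (by rw [← hΦw]; exact hstrictw)) (Filter.inter_mem ?_ (hNzo.mem_nhds hwN))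
    have hAw : ContinuousAt A w₀ := continuousAt_iter_of_loopSmall (P := P) (N := N) hαδ w₀ fun k hk c' i => by
      have h := hstrictw k hk c' i
      rw [hΦw] at h
      exact h.le
    refine hAw.preimage_mem_nhds (hNVo.mem_nhds ?_)
    have hAw₀ : A w₀ = V := by
      have h := hfib V w₀ ((hJT _ _).2 hVw)
      rwa [hΦw] at h
    rw [hAw₀]; exact hVN
  have hpos : 0 < ν ({U : GaugeField P 0 (SU N) | ∀ k, k < n → ∀ (c' : PBond P (k + 1)) (i : Idx P),
      dist1 (loopHol (Averaging.iter (fun i => BlockAveraging.blockAvg (P := P) (j := i) (expMeanLogSU (n := Fin N))) k U) c' i) < α} ∩ B) :=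
    Measure.measure_pos_of_mem_nhds ν hwB
  have hle : ν ({U : GaugeField P 0 (SU N) | ∀ k, k < n → ∀ (c' : PBond P (k + 1)) (i : Idx P),
      dist1 (loopHol (Averaging.iter (fun i => BlockAveraging.blockAvg (P := P) (j := i) (expMeanLogSU (n := Fin N))) k U) c' i) < α} ∩ B) ≤
      ν (B ∩ (A ⁻¹' univ ∩ {U | ∀ c, U (iterCentralBond n c) ∈ chainWindow (N := N) α n U c})) := by
    refine measure_mono fun U hU => ⟨hU.2, mem_univ _, ?_⟩
    exact mem_chartWindowSet_of_loopSmall (P := P) (N := N) hn U (fun k hk c' i => (hU.1 k hk c' i).le)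
  have hval : ν (B ∩ (A ⁻¹' univ ∩ {U | ∀ c, U (iterCentralBond n c) ∈ chainWindow (N := N) α n U c})) =
      ((μ.prod ν).withDensity J) (Φ ⁻¹' B) := by
    rw [← Measure.restrict_apply hBm, hlaw univ MeasurableSet.univ, Measure.restrict_univ, Measure.map_apply hΦm hBm]
  have hzero : ((μ.prod ν).withDensity J) (Φ ⁻¹' B) = 0 := by
    refine le_antisymm ((measure_mono hsub).trans ((measure_union_le _ _).trans ?_)) bot_le
    have h1 : ((μ.prod ν).withDensity J) {p | Jac (γ p) ≠ Jac p} = 0 := withDensity_absolutelyContinuous _ _ hE0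
    have h2 : ((μ.prod ν).withDensity J) {p | J p = 0} = 0 := by
      have hS : MeasurableSet {p : GaugeField P n (SU N) × GaugeField P 0 (SU N) | J p = 0} := hJmeas (measurableSet_singleton 0)
      rw [withDensity_apply _ hS, setLIntegral_congr_fun hS (fun p hp => hp), lintegral_zero]
    rw [h1, h2, add_zero]
  have := hpos.trans_le (hle.trans (hval.trans hzero).le)
  exact lt_irrefl _ this

end Summit.QuantumFields.YangMills.Theorems.FluctuationComparisonRegPrIntLS2BetaChartContCovariancePointwise

end
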